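import Summits.QuantumFields.GaugeBoot.DiagonalRPTorusResampling
import Summits.QuantumFields.GaugeBoot.DiagonalRPTorusColumns
import Summits.QuantumFields.GaugeBoot.DiagonalRPTorusGaugeInvariantNegative
import Literature.MathematicalPhysics.QuantumFieldTheory.LatticeGaugePlaquetteLowerBound
import HarnessLib

/-!
# Links, heights and one-link updates over a column of `(ℤ/L)³` (gauge-boot, task L3(ξ))

HONEST FRAMING (cell `pub-gaugeboot`, page 1 of every file): the venture produces certified bounds
on lattice expectations at stated coupling, gauge group, dimension and torus size; NOT a mass gap,
NOT a continuum limit, NOT a string tension; NOT Yang–Mills-summit-bearing (barriers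
`FixedCouplingUltralocality`, `PerturbativeInvisibility`). This module is geometric and
algebraic bookkeeping for the structural NEGATIVE result `DiagonalRPTorusNegativeOddSUN`
(closed-half diagonal RP fails on odd three-tori for `G ≅ SU(N)` at small coupling); it
discharges nothing by itself.

## Content (torus `(ℤ/L)³`, spectator direction `2`, columns `A ∈ (ℤ/L)²`, `vsite A z` of
`DiagonalRPTorusColumns`)

* heights: `vsite_add_single_two`, `vsite_eq_vsite_iff`, `natCast_eq_natCast_iff_of_lt`,
  `natCast_succ_ne`, `bump_ne_self`, `prod_range_natCast` (re-indexing `∏_{i<L}` over `ℤ/L`);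
* one-link updates `U[e ↦ s]`: a vertical line holonomy over `A` does not read links off the
  column (`lineHolonomy_update_of_ne`, `_of_snd_ne_two`, `_of_col_ne`), a plaquette does not
  read links it does not contain (`plaqRe_update_of_ne`), the rung plaquette
  `p_z = (vsite B z, (a, 2))` reads `r_z a_z r_{z+1}⁻¹ b_z⁻¹` (`plaqRe_rung`) and no horizontal
  link of another height (`plaqRe_rung_update_horizontal`); `reTr_mul_comm` (`Re χ` is a class
  function).

Elementary; no definition, no named fact.
-/

open MeasureTheory Complex Finset Function
open scoped ComplexOrder

namespace Summit.QuantumFields.GaugeBoot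

open Literature.MathematicalPhysics.QuantumFieldTheory
open Literature.MathematicalPhysics.QuantumFieldTheory.PlaquetteLowerBound (reTr charVariance)
open Literature.RepresentationTheory.CompactGroups

noncomputable section

namespace DiagRPSUN

open DiagRPThree DiagRPPolyakov

/-! ## Heights and links over a column -/

section Geometry

variable {L : ℕ}

/-- Vertical translation of a vertical site. -/
theorem vsite_add_single_two (A : ZMod L × ZMod L) (z w : ZMod L) :
    vsite A z + Pi.single (2 : Fin 3) w = vsite A (z + w) := by
  funext i
  fin_cases i <;> simp [vsite]

/-- Two vertical sites coincide iff columns and heights do. -/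
theorem vsite_eq_vsite_iff {A B : ZMod L × ZMod L} {z w : ZMod L} :
    vsite A z = vsite B w ↔ A = B ∧ z = w := by
  rw [eq_vsite_iff, Prod.ext_iff]
  simp [vsite]

/-- Casting `ℕ → ℤ/L` is injective below `L`. -/
theorem natCast_eq_natCast_iff_of_lt {k m : ℕ} (hk : k < L) (hm : m < L) :
    ((k : ZMod L) = (m : ZMod L)) ↔ k = m := by
  constructor
  · intro h
    have := congrArg ZMod.val h
    rwa [ZMod.val_natCast, ZMod.val_natCast, Nat.mod_eq_of_lt hk, Nat.mod_eq_of_lt hm] at this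
  · rintro rfl
    rfl

/-- `k + 1 ≢ k (mod L)` for `L ≥ 2`. -/
theorem natCast_succ_ne (hL : 1 < L) (k : ℕ) : ((k + 1 : ℕ) : ZMod L) ≠ (k : ZMod L) := by
  intro h
  push_cast at h
  have h1 : (1 : ZMod L) = 0 := by simpa using h
  have := (ZMod.val_eq_zero (1 : ZMod L)).2 h1
  rw [ZMod.val_one'' hL.ne'] at this
  exact one_ne_zero this

/-- A nearest-neighbour column differs from the column (`L ≥ 2`). -/
theorem bump_ne_self (hL : 1 < L) {a : Fin 3} (ha : a ≠ 2) (B : ZMod L × ZMod L) :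
    bump a B ≠ B := by
  have h1 : (1 : ZMod L) ≠ 0 := fun h => by
    have := (ZMod.val_eq_zero (1 : ZMod L)).2 h
    rw [ZMod.val_one'' hL.ne'] at this
    exact one_ne_zero this
  intro h
  unfold bump at h
  have ha' : a = 0 ∨ a = 1 := by
    rcases Fin.eq_zero_or_eq_succ a with h0 | ⟨j, rfl⟩
    · exact Or.inl h0
    · rcases Fin.eq_zero_or_eq_succ j with h0 | ⟨i, rfl⟩
      · exact Or.inr (by rw [h0]; rfl)
      · exact absurd (by rw [Fin.eq_zero i]; rfl) ha
  rcases ha' with rfl | rfl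
  · exact h1 (by simpa using congrArg Prod.fst h)
  · exact h1 (by simpa using congrArg Prod.snd h)

variable [NeZero L]

/-- The range product re-indexed over `ℤ/L`. -/
theorem prod_range_natCast {M : Type*} [CommMonoid M] (f : ZMod L → M) :
    ∏ i ∈ range L, f (i : ZMod L) = ∏ z : ZMod L, f z := by
  have hinj : Set.InjOn (fun i : ℕ => (i : ZMod L)) (range L : Finset ℕ) := by
    intro i hi j hj h
    exact (natCast_eq_natCast_iff_of_lt (mem_range.1 hi) (mem_range.1 hj)).1 h
  rw [← prod_image hinj]
  congr 1
  ext z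
  simp only [mem_image, mem_range, mem_univ, iff_true]
  exact ⟨z.val, ZMod.val_lt z, ZMod.natCast_zmod_val z⟩

end Geometry

/-! ## Line holonomies, plaquettes and one-link updates -/

section Update

variable {L : ℕ} {G : Type*} [Group G]

/-- The first step of a line holonomy. -/
theorem lineHolonomy_eq_mul (U : GaugeConfig 3 L G) (k : Fin 3) {n : ℕ} (hn : 0 < n)
    (y : Site 3 L) : lineHolonomy U k n y = U (y, k) * lineHolonomy U k (n - 1) (y.shift k) := by
  obtain ⟨m, rfl⟩ := Nat.exists_eq_succ_of_ne_zero hn.ne'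
  rfl

/-- A vertical line holonomy over the column `A` does not read a link it does not contain. -/
theorem lineHolonomy_update_of_ne {U : GaugeConfig 3 L G} {e : Edge 3 L} {s : G}
    (A : ZMod L × ZMod L) (z : ZMod L) (n : ℕ)
    (h : ∀ t : ℕ, t < n → (vsite A (z + (t : ZMod L)), (2 : Fin 3)) ≠ e) :
    lineHolonomy (update U e s) 2 n (vsite A z) = lineHolonomy U 2 n (vsite A z) := by
  refine WilsonLoopRP.lineHolonomy_congr 2 n (vsite A z) fun t ht => ?_
  rw [vsite_add_single_two]
  exact update_of_ne (h t ht) _ _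

/-- A vertical line over `A` does not read horizontal links. -/
theorem lineHolonomy_update_of_snd_ne_two {U : GaugeConfig 3 L G} {e : Edge 3 L} {s : G}
    (he : e.2 ≠ 2) (A : ZMod L × ZMod L) (z : ZMod L) (n : ℕ) :
    lineHolonomy (update U e s) 2 n (vsite A z) = lineHolonomy U 2 n (vsite A z) :=
  lineHolonomy_update_of_ne A z n fun _ _ hq => he (by rw [← hq])

/-- A vertical line over `A` does not read vertical links over another column. -/
theorem lineHolonomy_update_of_col_ne {U : GaugeConfig 3 L G} {s : G} {A C : ZMod L × ZMod L}
    (hAC : A ≠ C) (w : ZMod L) (z : ZMod L) (n : ℕ) :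
    lineHolonomy (update U (vsite C w, (2 : Fin 3)) s) 2 n (vsite A z) =
      lineHolonomy U 2 n (vsite A z) :=
  lineHolonomy_update_of_ne A z n fun _ _ hq =>
    hAC (vsite_eq_vsite_iff.1 (congrArg Prod.fst hq)).1

variable {N : ℕ} (ρ : G →* Matrix (Fin N) (Fin N) ℂ)

/-- `Re tr ρ` is a class function: `Re χ(x y) = Re χ(y x)`. -/
theorem reTr_mul_comm (x y : G) : reTr ρ (x * y) = reTr ρ (y * x) := by
  unfold reTr
  rw [map_mul, map_mul, Matrix.trace_mul_comm]

/-- A plaquette value does not read a link it does not contain. -/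
theorem plaqRe_update_of_ne {U : GaugeConfig 3 L G} {e : Edge 3 L} {s : G} (p : Plaquette 3 L)
    (h1 : (p.1, p.2.1.1) ≠ e) (h2 : (p.1.shift p.2.1.1, p.2.1.2) ≠ e)
    (h3 : (p.1.shift p.2.1.2, p.2.1.1) ≠ e) (h4 : (p.1, p.2.1.2) ≠ e) :
    WilsonRP.plaqRe ρ (update U e s) p = WilsonRP.plaqRe ρ U p := by
  unfold WilsonRP.plaqRe plaquetteHolonomy
  rw [update_of_ne h1, update_of_ne h2, update_of_ne h3, update_of_ne h4]

variable (pl : {q : Fin 3 × Fin 3 // q.1 < q.2}) (hpl : pl.1.2 = 2) (B : ZMod L × ZMod L)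

include hpl in
/-- The horizontal direction of a vertical coordinate plane is not the spectator direction. -/
theorem fst_ne_two : pl.1.1 ≠ 2 := fun h => by
  have := pl.2
  rw [h, hpl] at this
  exact lt_irrefl _ this

include hpl in
/-- **The rung plaquette** `p_z = (vsite B z, (a,2))`:
`Re tr ρ(U_{p_z}) = Re χ(r_z a_z r_{z+1}⁻¹ b_z⁻¹)` with `r_z = U(vsite B z, a)`,
`a_z = U(vsite (B+e_a) z, 2)`, `b_z = U(vsite B z, 2)`. -/
theorem plaqRe_rung (U : GaugeConfig 3 L G) (z : ZMod L) :
    WilsonRP.plaqRe ρ U (vsite B z, pl) = reTr ρ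
      (U (vsite B z, pl.1.1) * U (vsite (bump pl.1.1 B) z, 2) *
        (U (vsite B (z + 1), pl.1.1))⁻¹ * (U (vsite B z, 2))⁻¹) := by
  unfold WilsonRP.plaqRe plaquetteHolonomy reTr
  simp only
  rw [hpl, vsite_shift_of_ne_two B z (fst_ne_two pl hpl), vsite_shift_two]

include hpl in
/-- A rung plaquette does not read the horizontal link `(vsite B w, a)` of another height
(`w ∉ {z, z+1}`). -/
theorem plaqRe_rung_update_horizontal {U : GaugeConfig 3 L G} {s : G} {z w : ZMod L}
    (hw : w ≠ z) (hw' : w ≠ z + 1) :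
    WilsonRP.plaqRe ρ (update U (vsite B w, pl.1.1) s) (vsite B z, pl) =
      WilsonRP.plaqRe ρ U (vsite B z, pl) := by
  have ha := fst_ne_two pl hpl
  refine plaqRe_update_of_ne ρ _ ?_ ?_ ?_ ?_
  · exact fun h => hw (vsite_eq_vsite_iff.1 (congrArg Prod.fst h)).2.symm
  · rw [hpl]; exact fun h => ha (congrArg Prod.snd h).symm
  · simp only [hpl, vsite_shift_two]
    exact fun h => hw' (vsite_eq_vsite_iff.1 (congrArg Prod.fst h)).2.symm
  · rw [hpl]; exact fun h => ha (congrArg Prod.snd h).symm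

end Update


end DiagRPSUN

end

end Summit.QuantumFields.GaugeBoot
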